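import Mathlib
import HarnessLib
import Summits.HubbardSuperconductivity.HubbardSuperconductivity.Theorems.KLProgrammeKLRegimeEnginePairTransferMemberDifference
import Literature.MathematicalPhysics.QuantumLattice.GrassmannGaussConvBinomialGram

/-!
# Route `KLProgramme` — ENGINE child gen 8 (stmt-HubbardSuperconductivity-20437 `KLRegimeEngineV17F2`), skeleton v2 class #5 rev 3: the member DIFFERENCE through the
# binomial–Gram smearing bound — `klmf_vertexFn_gaussConv_sub_le_binomial`, **`klmf_memberAmplitude_sub_le_binomial`**
# (cell gate-hubbard-kl, seat hubbard-kl-k3c1-p1 g11, technique «composed-map remainder propagation»; the composition (ii)∘(i) of (R95) for the class-#5 base and steps)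

WHY.  By `klmf_carrier_sub_eq` (p593510) two members of the same action differ by `(e^{Δ_{S_D}} − 1)` applied to the second (`D = ψ₁ − ψ₂`).  The Literature binomial–Gram
bound `sum_norm_kernel_gaussConv_sub_le_binomial_of_gramBounded` (BGM 2006 (2.61)–(2.66)) controls exactly `e^{Δ_C}H − H` in pinned `L¹` kernel norms from a Gram constant `κ`
of `C` (`IsGramBoundedR C κ`) and the pinned norms `N(m′)` of the HIGHER kernels of `H`.  This file composes the two ON `HubbardFieldIdx` (no grid pullback in the statement):
* `klmf_vertexFn_gaussConv_sub_le_binomial` — `‖𝒱_{2·2}(e^{Δ_D}H − H)(X)‖ ≤ (4!·|βL²|³)·Σ_{m′ > 2} C(2m′,4)·κ^{2m′−4}·N(m′)` for every label tuple `X` (even `H`);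
* **`klmf_memberAmplitude_sub_le_binomial`** — for two symbols `ψ₁, ψ₂` at frame `K`, scale `n`: `‖𝒱₄(e^{Δ_{S_{ψ₁}}}𝒱ₙ)(X) − 𝒱₄(e^{Δ_{S_{ψ₂}}}𝒱ₙ)(X)‖ ≤` the same, with
  `D := softCovOf K (ψ₁ − ψ₂)` and `H := e^{Δ_{softCovOf K ψ₂}}𝒱ₙ[K]` — the `η` of `pairTransferRelResIdx_zero_of_smearingBound` (n = 0) and of `klmf_defect_sub_le` (steps) from
  (i) the pinned kernel norms of `e^{Δ_{S_{ψ₂}}}𝒱ₙ` and (ii) a MASS-sensitive Gram constant `κ_D` of the `D`-line (scale-0 / EdgeFacts lanes).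
Composition over Literature lemmas; nothing about the model's sizes is asserted; nothing asserts superconductivity.  0 kit.
-/

noncomputable section

namespace Summit.HubbardSuperconductivity.HubbardSuperconductivity.Theorems.KLRegimeSplit

set_option linter.dupNamespace false -- summit = problem name (single-conjunct summit), D-0017

open Finset Matrix Set Literature.MathematicalPhysics.QuantumLattice Literature.Probability.LatticeModels GrassmannAlgebra
open Summit.HubbardSuperconductivity.HubbardSuperconductivity.Theorems.KLProgrammeLegKernels
open Summit.HubbardSuperconductivity.HubbardSuperconductivity.Theorems.DispersionFlow
open Summit.HubbardSuperconductivity.HubbardSuperconductivity.Theorems.EngineV8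

section Binomial

variable (L M : ℕ) [NeZero L] (β : ℝ)

/-- **Pointwise vertex-function form of the binomial–Gram smearing bound** in degree `4 = 2·2`: for even `H`, `IsGramBoundedR D κ`, pinned kernel norms `N`:
`‖𝒱₄(e^{Δ_D}H − H)(X)‖ ≤ ((2·2)!·|βL²|^{2·2−1})·Σ_{m′} [2 < m′]·C(2m′, 2·2)·κ^{2m′−2·2}·N(m′)`. -/
theorem klmf_vertexFn_gaussConv_sub_le_binomial {D : Matrix (HubbardFieldIdx L M) (HubbardFieldIdx L M) ℂ} {κ : ℝ} (hκ : 0 ≤ κ)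
    (hGB : IsGramBoundedR D κ) (H : HubbardGrassmann L M) (hH : H ∈ evenPart ℂ (HubbardFieldIdx L M)) (N : ℕ → ℝ) (hN0 : ∀ m', 0 ≤ N m')
    (hN : ∀ m' (j : Fin (2 * m')) (w : HubbardFieldIdx L M),
      ∑ Y ∈ univ.filter (fun Y : Fin (2 * m') → HubbardFieldIdx L M => Y j = w), ‖kernel ℂ H (2 * m') Y‖ ≤ N m')
    (X : Fin (2 * 2) → HubbardFieldIdx L M) :
    ‖vertexFn L M β (gaussConv ℂ D H - H) (2 * 2) X‖ ≤
      (((2 * 2).factorial : ℝ) * |β * (L : ℝ) ^ 2| ^ (2 * 2 - 1)) *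
        ∑ m' ∈ range (Fintype.card (HubbardFieldIdx L M) / 2 + 1),
          if 2 < m' then ((2 * m').choose (2 * 2) : ℝ) * κ ^ (2 * m' - 2 * 2) * N m' else 0 := by
  have hsum := sum_norm_kernel_gaussConv_sub_le_binomial_of_gramBounded (𝕜 := ℂ) D hκ hGB H hH N hN0 hN (p := 2) (0 : Fin (2 * 2)) (X 0)
  have hsingle : ‖kernel ℂ (gaussConv ℂ D H - H) (2 * 2) X‖ ≤
      ∑ W ∈ univ.filter (fun W : Fin (2 * 2) → HubbardFieldIdx L M => W 0 = X 0), ‖kernel ℂ (gaussConv ℂ D H - H) (2 * 2) W‖ :=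
    single_le_sum (f := fun W => ‖kernel ℂ (gaussConv ℂ D H - H) (2 * 2) W‖) (fun W _ => norm_nonneg _) (by simp)
  rw [vertexFn_def, norm_mul, Complex.norm_real, Real.norm_eq_abs, abs_mul, abs_pow, Nat.abs_cast]
  exact mul_le_mul_of_nonneg_left (hsingle.trans hsum) (by positivity)

/-- **The member difference through the binomial–Gram bound**: for symbols `ψ₁, ψ₂` at frame `K`, scale `n`, with `D := softCovOf K (ψ₁ − ψ₂)` Gram-bounded by `κ` and the pinned
kernel norms `N` of `H := e^{Δ_{softCovOf K ψ₂}}𝒱ₙ[K]` (even): `‖𝒱₄(e^{Δ_{S_{ψ₁}}}𝒱ₙ)(X) − 𝒱₄(e^{Δ_{S_{ψ₂}}}𝒱ₙ)(X)‖ ≤ (4!·|βL²|³)·Σ_{m′>2} C(2m′,4)κ^{2m′−4}N(m′)`. -/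
theorem klmf_memberAmplitude_sub_le_binomial (U μ : ℝ) (K : TrigPolyC4v) (n : ℕ) (ψ₁ ψ₂ : FreqMomentum L M → ℝ) {κ : ℝ} (hκ : 0 ≤ κ)
    (hGB : IsGramBoundedR (softCovOf L M β μ K (ψ₁ - ψ₂)) κ)
    (hH : gaussConv ℂ (softCovOf L M β μ K ψ₂) (klEffectiveAction L M β U μ K klE0 n) ∈ evenPart ℂ (HubbardFieldIdx L M)) (N : ℕ → ℝ)
    (hN0 : ∀ m', 0 ≤ N m')
    (hN : ∀ m' (j : Fin (2 * m')) (w : HubbardFieldIdx L M),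
      ∑ Y ∈ univ.filter (fun Y : Fin (2 * m') → HubbardFieldIdx L M => Y j = w),
        ‖kernel ℂ (gaussConv ℂ (softCovOf L M β μ K ψ₂) (klEffectiveAction L M β U μ K klE0 n)) (2 * m') Y‖ ≤ N m')
    (X : Fin (2 * 2) → HubbardFieldIdx L M) :
    ‖vertexFn L M β (gaussConv ℂ (softCovOf L M β μ K ψ₁) (klEffectiveAction L M β U μ K klE0 n)) (2 * 2) X -
        vertexFn L M β (gaussConv ℂ (softCovOf L M β μ K ψ₂) (klEffectiveAction L M β U μ K klE0 n)) (2 * 2) X‖ ≤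
      (((2 * 2).factorial : ℝ) * |β * (L : ℝ) ^ 2| ^ (2 * 2 - 1)) *
        ∑ m' ∈ range (Fintype.card (HubbardFieldIdx L M) / 2 + 1),
          if 2 < m' then ((2 * m').choose (2 * 2) : ℝ) * κ ^ (2 * m' - 2 * 2) * N m' else 0 := by
  -- the two carriers differ by `(e^{Δ_{S_D}} − 1)` applied to the second (`klmf_carrier_sub_eq` at `Λ₁ = Λ = Λₙ`)
  have hsub := klmf_vertexFn_carrier_sub_eq L M β μ K ψ₁ ψ₂ (klScale klE0 n) (klScale klE0 n)
    (hubbardEffectiveActionCT L M β U μ 0 K (klScale klE0 n)) (2 * 2) X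
  simp only [add_sub_cancel_right] at hsub
  have hV : hubbardEffectiveActionCT L M β U μ 0 K (klScale klE0 n) = klEffectiveAction L M β U μ K klE0 n := rfl
  rw [hV] at hsub
  rw [hsub]
  exact klmf_vertexFn_gaussConv_sub_le_binomial L M β hκ hGB _ hH N hN0 hN X

end Binomial

end Summit.HubbardSuperconductivity.HubbardSuperconductivity.Theorems.KLRegimeSplit

end
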